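import Summits.QuantumAdvantage.QuantumAdvantage.Theorems.WbwObfuscatedGluedTreesKowRiVocabulary
import Summits.QuantumAdvantage.QuantumAdvantage.Theorems.WbwObfuscatedGluedTreesKowRiLr4Ratio
import Summits.QuantumAdvantage.QuantumAdvantage.Theorems.WbwObfuscatedGluedTreesKowRiPrpTable
import Summits.QuantumAdvantage.QuantumAdvantage.Theorems.WbwObfuscatedGluedTreesKowRiCycleRatio
import Summits.QuantumAdvantage.QuantumAdvantage.Theorems.WbwObfuscatedGluedTreesKowRiLocality
import Summits.QuantumAdvantage.QuantumAdvantage.Theorems.WbwObfuscatedGluedTreesKowRiHcoeffCycle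
import Summits.QuantumAdvantage.QuantumAdvantage.Theorems.WbwObfuscatedGluedTreesKowRiNamingCode
import Summits.QuantumAdvantage.QuantumAdvantage.Theorems.WbwObfuscatedGluedTreesKowRiAverage
import Summits.QuantumAdvantage.QuantumAdvantage.Theorems.WbwObfuscatedGluedTreesKowRiCodeLink
import Summits.QuantumAdvantage.QuantumAdvantage.Theorems.WhiteBoxWalkWbwObfuscatedGluedTreesBlackBox

/-!
# Line `knowledge-of-walk-split`, STAGE 6 — REAL→IDEAL statistical layer: IDEAL MODEL II (the generator's own naming /
# Feistel code over uniformly random PRF tables) is as sound against black-box walkers as stage 5's ideal model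
# (crux `WbwObfuscatedGluedTrees`, stmt-QuantumAdvantage-2340, route WhiteBoxWalk; lead prover-line-stmt-QuantumAdvantage-2340-c5-0)

Stage 5 (`blackBoxSoundness_holds`, p143810) bounded every computationally unbounded bit-oracle walker with `t ≤ 2^{d/6}`
rounds in the IDEAL model (uniform cycle datum; SIV names over uniform tag / mask tables) by `4·2^{-d/6} + 2·tagSlack d μ`,
and left the real→ideal bridge open ("honest scope").  The landed generator's instance is NOT ideal: its naming is
`sivEnc` over `F_{k₁}, F_{k₂}` with `fit`ted values and its cycle datum `cycleOf` is a pair of FOUR-ROUND KEYED FEISTEL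
permutations `prp` (round functions off `F_{k₃}, F_{k₄}`), queried by the neighbour function in BOTH directions.
Stage 6 proves the STATISTICAL half of the bridge.  IDEAL MODEL II runs the generator's own code (`naming`, `cycleOf`,
verbatim, through the table scheme `tabScheme`) over four uniformly random `μ`-bit tables in place of the four PRF
instances; target `IdealCodeSoundness`:

* (i) for `1 ≤ d`, `2d + 3 ≤ μ` (no label truncation, T9), `d + 8 ≤ μ` (domain-separated round functions), `t ≤ 2^{d/6}`:
  `codeSuccessProb d μ M x t ≤ 4·2^{-d/6} + 2·tagSlack d μ + 2·lrSlack ⌊d/2⌋ ⌈d/2⌉ (2t)` — stage 5's bound plus a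
  Luby–Rackoff strong-PRP slack (`lrSlack a b q = q²(2^{-a} + 2^{-b} + 2^{-(a+b)})`, here `≤ 12·t²·2^{-⌊d/2⌋}`);
* (ii) the generator's own naming and cycle datum ARE ideal-model-II code run at the tables of its four keys
  (`naming P μ k₁ k₂ d = codeNaming (tablesOf P μ k₁ k₂ k₃ k₄) d`, `cycleOf P μ k₃ k₄ d = codeCycle (tablesOf …) d`),
  so that the only remaining real→ideal step is the replacement of the four PRF instances `P.eval μ kᵢ` by uniformly
  random tables — four textbook PRF hybrids (computational; stage 7).

Composition `WbwObfuscatedGluedTrees_of` from eight registered stubs (§1):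
`codeSuccessProb ≤ sivSuccessProb + 2·lrSlack` by AVERAGING (`stub_average`) over the naming pair the per-naming CYCLE
bound (`stub_hcoeffCycle`: Patarin's coefficient-H bound `OracleAlg.hcoeff_abs_le` on the bit-oracle game, whose
consistency events decompose along the ATOMS of the cycle datum — `stub_locality`: the bit oracle reads `σ` only through
`≤ 2` point constraints per permutation per query — into cylinder events, on which the ratio
`Pr_code ≥ (1 − 2·lrSlack)·Pr_uniform` is `stub_cycleRatio` = `stub_lr4Ratio` (Luby–Rackoff 1988 Thm 2 as an
H-coefficient count for the abstract 4-round Feistel `psi`) transported along `stub_prpTable` (the generator's `prp` IS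
`psi` of the effective key of its table, and the effective key of a uniform table is uniform)), the naming layer being
EXACTLY ideal (`stub_namingCode`: the code naming is `sivNaming` of the tag / mask tables of the two naming tables, which
are uniform); then stage 5.  Conjunct (ii) is `stub_codeLink`.
-/

set_option linter.dupNamespace false

noncomputable section

namespace Summit.QuantumAdvantage.QuantumAdvantage.Cruxes.WbwObfuscatedGluedTrees.KnowledgeOfWalkSplit.RealIdeal

open Literature.Computability.Complexity Literature.Computability.QuantumComplexity
open Literature.Computability.QuantumComplexity.GluedTrees
open Literature.Computability.Cryptography Literature.Computability.Cryptography.ObfuscatedGluedTrees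
open Summit.QuantumAdvantage.QuantumAdvantage.Theorems.WbwObfuscatedGluedTrees.KnowledgeOfWalk.BlackBox
open Summit.QuantumAdvantage.QuantumAdvantage.Theorems.WbwObfuscatedGluedTrees.KnowledgeOfWalk.RealIdeal

/-! ## §1 The eight stubs — all LANDED as their own files (imported above) and used BY NAME in `idealCodeSoundness_holds`;
## their statements are the aliases `Registered.stub_*` below (textually the registered stubs)

* `stub_lr4Ratio` (p150798 `KowRiLr4Ratio`, aux p150406) — Luby–Rackoff 1988, Theorem 2, as a coefficient-H count: for the
  abstract four-round Feistel `psi` over a uniformly random key of four round functions between halves of `a` and `b` bits,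
  every cylinder event (a list of point ↦ value constraints — what a two-sided transcript imposes) has probability at least
  `(1 − lrSlack a b |L|)` times its probability for a uniformly random permutation.
* `stub_prpTable` (p149389 `KowRiPrpTable`) — format bridge: the generator's keyed permutation `prp` over the table scheme IS
  `psi` of the effective key of the selected table, conjugated by `splitVec`/`joinVec`; for `d + 8 ≤ μ` the effective key of
  a uniformly random `μ`-bit table is a uniformly random Luby–Rackoff key.
* `stub_cycleRatio` (p148914 `KowRiCycleRatio`) — the cylinder ratio for the code cycle pair (transport along
  `bitVecEquiv`/`splitEquiv`, product over the two independent permutations: `(1 − s)² ≥ 1 − 2s`).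
* `stub_locality` (p148576 `KowRiLocality`) — the bit oracle reads the cycle datum only through the ATOM at the vertex a
  query is about; `atomOf σ v = α` is shape ∧ cylinder ∧ cylinder (`atomPairs`, ≤ 2 constraints per permutation).
* `stub_hcoeffCycle` (p148575 `KowRiHcoeffCycle`, the lead's) — Patarin's `OracleAlg.hcoeff_abs_le` on the bit-oracle game
  along atoms, no bad transcripts.
* `stub_namingCode` (p148871 `KowRiNamingCode`) — the naming layer of ideal model II is EXACTLY stage 5's ideal naming;
  `(H₀, H₁) ↦ (tagT H₀ d, maskT H₁ d)` is equidistributed for `2d + 3 ≤ μ`.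
* `stub_average` (p149027 `KowRiAverage`) — Fubini over the two table pairs: `codeSuccessProb ≤ sivSuccessProb + ε`.
* `stub_codeLink` (p148589 `KowRiCodeLink`) — the generator's naming and cycle datum are ideal-II code at the tables of its
  own four keys.
-/

/-! ### Name-keyed aliases of the eight statements (hypotheses of the composition; textually the registered stubs) -/
namespace Registered

/-- Statement of `stub_lr4Ratio`. -/
abbrev stub_lr4Ratio : Prop :=
  ∀ (a b : ℕ) (L : List (((Fin a → Bool) × (Fin b → Bool)) × ((Fin a → Bool) × (Fin b → Bool)))),
    (1 - lrSlack a b L.length) *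
        finProb (PMF.uniformOfFintype (Equiv.Perm ((Fin a → Bool) × (Fin b → Bool)))) (fun π => Cyl L π) ≤
      finProb (PMF.uniformOfFintype (LRKey a b)) (fun f => Cyl L (psi f))
open Classical in
/-- Statement of `stub_prpTable`. -/
abbrev stub_prpTable : Prop :=
  (∀ (μ d : ℕ) (H : CodeSpace μ) (i : Fin 4) (w : Fin d → Bool),
      prp (tabScheme H) μ (tkey i) d w = joinVec d (psi (effKey (H.tab i) d) (splitVec d w))) ∧
    (∀ (μ d : ℕ), d + 8 ≤ μ → ∀ e : LRKey (d / 2) (d - d / 2),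
      (Finset.univ.filter fun H : PrfTable μ => effKey H d = e).card * Fintype.card (LRKey (d / 2) (d - d / 2)) =
        Fintype.card (PrfTable μ))
open Classical in
/-- Statement of `stub_cycleRatio`. -/
abbrev stub_cycleRatio : Prop :=
  ∀ (μ d t : ℕ), d + 8 ≤ μ → stub_lr4Ratio → stub_prpTable →
    ∀ (Hn : PrfTable μ × PrfTable μ) (L₁ L₂ : List (Fin (2 ^ d) × Fin (2 ^ d))),
      L₁.length ≤ 2 * t → L₂.length ≤ 2 * t →
      (1 - 2 * lrSlack (d / 2) (d - d / 2) (2 * t)) *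
          finProb (PMF.uniformOfFintype (CycleDatum d)) (fun σ => Cyl L₁ σ.1 ∧ Cyl L₂ σ.2) ≤
        finProb (PMF.uniformOfFintype (PrfTable μ × PrfTable μ))
          (fun Hc => Cyl L₁ (codeCycle (Hn, Hc) d).1 ∧ Cyl L₂ (codeCycle (Hn, Hc) d).2)
/-- Statement of `stub_locality`. -/
abbrev stub_locality : Prop :=
  (∀ (d N : ℕ), 1 ≤ d → ∀ (σ : CycleDatum d) (ν : NamingN d N) (α : Vertex d → Atom d) (q : List Bool),
      α (queryVertex ν q) = atomOf σ (queryVertex ν q) → bitOracleL ν α q = bitOracle σ ν q) ∧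
    (∀ (d : ℕ) (σ : CycleDatum d) (v : Vertex d) (α : Atom d),
      atomOf σ v = α ↔
        ((depth v = d ↔ α.isSome = true) ∧ Cyl (atomPairs v α).1 σ.1 ∧ Cyl (atomPairs v α).2 σ.2))
open Classical in
/-- Statement of `stub_hcoeffCycle`. -/
abbrev stub_hcoeffCycle : Prop :=
  ∀ (d N t : ℕ), 1 ≤ d → stub_locality →
    ∀ (Θ : Type) [Fintype Θ] [Nonempty Θ] (cyc : Θ → CycleDatum d) (ε : ℝ), 0 ≤ ε →
      (∀ L₁ L₂ : List (Fin (2 ^ d) × Fin (2 ^ d)), L₁.length ≤ 2 * t → L₂.length ≤ 2 * t →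
        (1 - ε) * finProb (PMF.uniformOfFintype (CycleDatum d)) (fun σ => Cyl L₁ σ.1 ∧ Cyl L₂ σ.2) ≤
          finProb (PMF.uniformOfFintype Θ) (fun θ => Cyl L₁ (cyc θ).1 ∧ Cyl L₂ (cyc θ).2)) →
      ∀ (ν : NamingN d N) (M : OracleAlg (List Bool)) (x : List Bool),
        ((Finset.univ.filter fun θ : Θ => BitSuccess M x t (cyc θ) ν).card : ℝ) / Fintype.card Θ ≤
          ((Finset.univ.filter fun σ : CycleDatum d => BitSuccess M x t σ ν).card : ℝ) /
              Fintype.card (CycleDatum d) + ε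
/-- Statement of `stub_namingCode`. -/
abbrev stub_namingCode : Prop :=
  (∀ (μ d : ℕ) (H : CodeSpace μ), codeNaming H d = sivNaming (tagT H.1.1 d) (maskT H.1.2 d)) ∧
    (∀ (μ d : ℕ), labelLen d ≤ μ → ∀ (E : TagTable d μ × MaskTable d μ → Prop) [DecidablePred E],
      (Finset.univ.filter fun Hn : PrfTable μ × PrfTable μ => E (tagT Hn.1 d, maskT Hn.2 d)).card *
          Fintype.card (TagTable d μ × MaskTable d μ) =
        (Finset.univ.filter E).card * Fintype.card (PrfTable μ × PrfTable μ))
open Classical in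
/-- Statement of `stub_average`. -/
abbrev stub_average : Prop :=
  ∀ (d μ : ℕ) (M : OracleAlg (List Bool)) (x : List Bool) (t : ℕ) (ε : ℝ),
    (∀ (μ d : ℕ) (H : CodeSpace μ), codeNaming H d = sivNaming (tagT H.1.1 d) (maskT H.1.2 d)) →
    (∀ (E : TagTable d μ × MaskTable d μ → Prop) [DecidablePred E],
      (Finset.univ.filter fun Hn : PrfTable μ × PrfTable μ => E (tagT Hn.1 d, maskT Hn.2 d)).card *
          Fintype.card (TagTable d μ × MaskTable d μ) =
        (Finset.univ.filter E).card * Fintype.card (PrfTable μ × PrfTable μ)) →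
    (∀ Hn : PrfTable μ × PrfTable μ,
      ((Finset.univ.filter fun Hc : PrfTable μ × PrfTable μ =>
            BitSuccess M x t (codeCycle (Hn, Hc) d) (sivNaming (tagT Hn.1 d) (maskT Hn.2 d))).card : ℝ) /
          Fintype.card (PrfTable μ × PrfTable μ) ≤
        ((Finset.univ.filter fun σ : CycleDatum d =>
            BitSuccess M x t σ (sivNaming (tagT Hn.1 d) (maskT Hn.2 d))).card : ℝ) / Fintype.card (CycleDatum d) + ε) →
    codeSuccessProb d μ M x t ≤ sivSuccessProb d μ M x t + ε
/-- Statement of `stub_codeLink`. -/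
abbrev stub_codeLink : Prop :=
  ∀ (P : PuncturablePRFScheme) (μ d : ℕ) (k₁ k₂ k₃ k₄ : List Bool),
    labelLen d ≤ μ → d ≤ μ →
      naming P μ k₁ k₂ d = codeNaming (tablesOf P μ k₁ k₂ k₃ k₄) d ∧
        cycleOf P μ k₃ k₄ d = codeCycle (tablesOf P μ k₁ k₂ k₃ k₄) d

end Registered

/-! ## §2 The target of stage 6 and its composition BY NAME -/

/-- **Stage-6 target: black-box soundness of IDEAL MODEL II** (the generator's own naming / Feistel code over four
uniformly random `μ`-bit tables). (i) the ideal-II success probability of every `t`-round bit-oracle walker,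
`t ≤ 2^{d/6}`, is at most stage 5's ideal bound plus the Luby–Rackoff slack `2·lrSlack ⌊d/2⌋ ⌈d/2⌉ (2t)`, in the region
`1 ≤ d`, `2d + 3 ≤ μ`, `d + 8 ≤ μ`; (ii) the generator's naming and cycle datum are ideal-II code at the tables of its
own four keys. -/
def IdealCodeSoundness : Prop :=
  (∀ (d μ : ℕ) (M : OracleAlg (List Bool)) (x : List Bool) (t : ℕ), 1 ≤ d → labelLen d ≤ μ → d + 8 ≤ μ →
      (t : ℝ) ≤ (2 : ℝ) ^ ((d : ℝ) / 6) →
      codeSuccessProb d μ M x t ≤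
        4 * (2 : ℝ) ^ (-((d : ℝ) / 6)) + 2 * tagSlack d μ + 2 * lrSlack (d / 2) (d - d / 2) (2 * t)) ∧
  (∀ (P : PuncturablePRFScheme) (μ d : ℕ) (k₁ k₂ k₃ k₄ : List Bool), labelLen d ≤ μ → d ≤ μ →
      naming P μ k₁ k₂ d = codeNaming (tablesOf P μ k₁ k₂ k₃ k₄) d ∧
        cycleOf P μ k₃ k₄ d = codeCycle (tablesOf P μ k₁ k₂ k₃ k₄) d)

/-- **Composition: the eight registered stubs give the stage-6 target BY NAME.** -/
theorem WbwObfuscatedGluedTrees_of (hA : Registered.stub_lr4Ratio) (hB : Registered.stub_prpTable)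
    (hB3 : Registered.stub_cycleRatio) (hC : Registered.stub_locality) (hE : Registered.stub_hcoeffCycle)
    (hD : Registered.stub_namingCode) (hF : Registered.stub_average) (hL : Registered.stub_codeLink) :
    IdealCodeSoundness := by
  classical
  refine ⟨fun d μ M x t hd hμ hμ' ht => ?_, hL⟩
  set ε : ℝ := 2 * lrSlack (d / 2) (d - d / 2) (2 * t) with hε
  have hε0 : 0 ≤ ε := by rw [hε]; exact mul_nonneg zero_le_two (lrSlack_nonneg _ _ _)
  -- the per-naming cycle bound (hcoeff along atoms, ratio from Luby–Rackoff through the format bridge)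
  have hcyc : ∀ Hn : PrfTable μ × PrfTable μ,
      ((Finset.univ.filter fun Hc : PrfTable μ × PrfTable μ =>
            BitSuccess M x t (codeCycle (Hn, Hc) d) (sivNaming (tagT Hn.1 d) (maskT Hn.2 d))).card : ℝ) /
          Fintype.card (PrfTable μ × PrfTable μ) ≤
        ((Finset.univ.filter fun σ : CycleDatum d =>
            BitSuccess M x t σ (sivNaming (tagT Hn.1 d) (maskT Hn.2 d))).card : ℝ) / Fintype.card (CycleDatum d) + ε := by
    intro Hn
    have h := hE d (nameLen μ d) t hd hC (PrfTable μ × PrfTable μ) (fun Hc => codeCycle (Hn, Hc) d) ε hε0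
      (fun L₁ L₂ h₁ h₂ => by rw [hε]; exact hB3 μ d t hμ' hA hB Hn L₁ L₂ h₁ h₂)
      (sivNaming (tagT Hn.1 d) (maskT Hn.2 d)) M x
    exact h
  have h1 : codeSuccessProb d μ M x t ≤ sivSuccessProb d μ M x t + ε :=
    hF d μ M x t ε hD.1 (fun E _ => hD.2 μ d hμ E) hcyc
  have h2 := Summit.QuantumAdvantage.QuantumAdvantage.Cruxes.WbwObfuscatedGluedTrees.KnowledgeOfWalkSplit.BlackBox.blackBoxSoundness_holds.1
    d μ M x t ht
  linarith

/-- **The stage-6 target holds**: the composition fed with the eight LANDED stubs (§1) by name. -/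
theorem idealCodeSoundness_holds : IdealCodeSoundness :=
  WbwObfuscatedGluedTrees_of
    Summit.QuantumAdvantage.QuantumAdvantage.Theorems.WbwObfuscatedGluedTrees.KnowledgeOfWalk.RealIdeal.stub_lr4Ratio
    Summit.QuantumAdvantage.QuantumAdvantage.Theorems.WbwObfuscatedGluedTrees.KnowledgeOfWalk.RealIdeal.stub_prpTable
    Summit.QuantumAdvantage.QuantumAdvantage.Theorems.WbwObfuscatedGluedTrees.KnowledgeOfWalk.RealIdeal.stub_cycleRatio
    Summit.QuantumAdvantage.QuantumAdvantage.Theorems.WbwObfuscatedGluedTrees.KnowledgeOfWalk.RealIdeal.stub_locality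
    Summit.QuantumAdvantage.QuantumAdvantage.Theorems.WbwObfuscatedGluedTrees.KnowledgeOfWalk.RealIdeal.stub_hcoeffCycle
    Summit.QuantumAdvantage.QuantumAdvantage.Theorems.WbwObfuscatedGluedTrees.KnowledgeOfWalk.RealIdeal.stub_namingCode
    Summit.QuantumAdvantage.QuantumAdvantage.Theorems.WbwObfuscatedGluedTrees.KnowledgeOfWalk.RealIdeal.stub_average
    Summit.QuantumAdvantage.QuantumAdvantage.Theorems.WbwObfuscatedGluedTrees.KnowledgeOfWalk.RealIdeal.stub_codeLink

end Summit.QuantumAdvantage.QuantumAdvantage.Cruxes.WbwObfuscatedGluedTrees.KnowledgeOfWalkSplit.RealIdeal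

end
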